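import Summits.QuantumFields.YangMills.Theorems.BalabanUVNodesN21AtKeyedRateHomeU2
import Summits.QuantumFields.YangMills.Theorems.BalabanUVNodesRateCarriersOfRecord12

/-!
# YM-DAG node N21 (= NE7c) AT THE STAGE-12 RATE-RECORD HOME `YMDAG.UVSplit.RRec₁₂ 𝔯` BY NAME: NE7c's `ShellWeightBound` at explicit carriers with the in-edge
# N16 supplied as the K4 stub `S_N16 (RRec₁₂ 𝔯)` (layer B at ₁₂, dag-n22-e), node U2's output at the datum of record, and the numerics letter `ν`, the sign
# `0 < ν.A₀` and the window bound `γ < 1` READ OFF the datum's canonical Stage-12 parameter (`Node00.IsDatumOfRecord₁₂C.params`, RR-2)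

Track A of `YM-PLAN.md` (cell `pub-ymgap`, HUMAN RULING D-0062), node **N21**; R134 fan-out seat `pub-ymgap-dag-n21-d` (s2 = BY-NAME KNIT at the record), generation 2,
module 7 — the ₁₂ INSTANCE of the stage-free modules 5 ∕ 6 (`BalabanUVNodesN21AtKeyedRateHome` p463475, `…U2` p464795) at the repaired record (`Node00/Record12.lean`
v2.2; the Stage-11 key is empty, `Node00.not_provisos₁₁`).  THEOREMS ONLY: 0 `def`, 0 `sorry`, standard axioms; COUNT-NEUTRAL; `--supports` the K3 item
K3′ `SpineGivenEndpointR12` (stmt-QuantumFields-19792).  Restate-immune (no Theses import).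

WHAT IS PROVED ([folklore]; each step ONE application BY NAME).
* §1 `nu_A0_pos_of_isDatumOfRecord₁₂C` (`0 < h.params.ν.A₀` from Stage-12 admissibility down to Stage 7's sign clause; `γ < 1` is RR-2's `IsDatumOfRecord₁₂C.gamma_lt_one`).
* §2 `shellWeightBound_geometric_of_rRec₁₂` — module 5's `shellWeightBound_geometric_of_ne3Layers` at the NE3 layers `K ↦ (𝔯.lit F h.params h.provisos g₀ os).ne3 K` of a
  Stage-12 rate reading `𝔯` at a datum key `h : IsDatumOfRecord₁₂C F N D`, the in-edge delivered by `s_N16_rRec₁₂_iff` from `S_N16 (RRec₁₂ 𝔯)`; threshold widths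
  displayed as hypotheses.
* §3 `shellWeightBound_geometric_of_rRec₁₂_u2Output` — module 6's `shellWeightBound_geometric_of_ne3Layers_u2Output` at the same layers with node U2's
  `U2Output D g₀ Cout θ₂` at the datum, the tuned window `D.Tuned h.params.γ g g₀` IN THE RECORD's OWN COUPLING WINDOW, the numerics `ν := h.params.ν` with
  `0 ≤ ν.A₀` and `γ < 1` DISCHARGED by §1; displayed remain the level ledgers ([dict] + (M1)), live windows, `D ≤ D̄`, END letters, the smallness
  `(1 + p₀∕log γ⁻²)γ²Cout ≤ 1∕2`, and the [dict] ∕ [dict-thr] clauses.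

HONEST FRAMING (binding).  `S_N16 (RRec₁₂ 𝔯)` is a HYPOTHESIS (content only through the PIN of `𝔯.lit · ne3`; NE3 NOT PROVED), `U2Output` a HYPOTHESIS (node U2 NOT
PRINTED), `𝔯` a RESIDUAL reading; no inhabitant of `IsDatumOfRecord₁₂C` is claimed (K0′ open); ledgers ∕ windows ∕ `D̄` ∕ END letters ∕ [dict] clauses displayed;
nothing of Bałaban's asserted; NE7c NOT PRINTED and NOT PROVED; **N21 NOT discharged**; typed 28∕28, discharged count untouched; one finite four-torus programme at
fixed `ε` — NOT ℝ⁴, NOT infinite volume, NOT OS, NOT a mass gap, NOT Clay.  No decl below carries a cite tag.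
-/

set_option autoImplicit false

noncomputable section

open scoped BigOperators Matrix Matrix.Norms.L2Operator

namespace Summit.QuantumFields.YangMills.Theorems.N21AtRRec12

open Literature.MathematicalPhysics.QuantumFieldTheory.Balaban1983to89
open Literature.MathematicalPhysics.QuantumFieldTheory.Balaban1983to89.T4Continuum (T4Family ULoop FiniteEpsData)
open B7Prop1Explicit B7Prop2Explicit
open T4AveragingDeficitWall (Plane)
open T4IndicatorShell (ShellWeightBound)
open T4ShellMeasureLevels (LevelLedger LiveWindow)
open Summit.QuantumFields.BalabanUV.T4Continuum
open Summit.QuantumFields.BalabanUV.T4Continuum.Spine.NE4 (U2Output runFlow box_and_pin_of_tuned)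
open MinimalActionSandwich (IsMinimiser)
open MinimalActionRate (Regular sfClass)
open MinimalActionRefine (RegularSup)
open AveragingDeficitDualResidual (dualC1 dualC2)
open AveragingDeficitDerivWallProof (wallConst)
open YMDAG.UVSplit (Datum S_N16 RateReading₁₂ RRec₁₂ s_N16_rRec₁₂_iff)
open N21AtKeyedRateHome (shellWeightBound_geometric_of_ne3Layers)
open N21AtKeyedRateHomeU2 (shellWeightBound_geometric_of_ne3Layers_u2Output)
open Node00 (IsDatumOfRecord₁₂C epsOfRecord)

variable {N : ℕ} [NeZero N]

/-! ## §1 Letters read off the datum's canonical Stage-12 parameter -/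

/-- **`0 < ν.A₀` AT THE RECORD**: the numerics of the datum's canonical Stage-12 parameter have a positive small-field constant `A₀` — Stage-12 admissibility
(RR-2's `IsDatumOfRecord₁₂C.admissible`) down to Stage 7's sign clause. [folklore] -/
theorem nu_A0_pos_of_isDatumOfRecord₁₂C {F : T4Family} {D : Datum F N} (h : IsDatumOfRecord₁₂C F N D) : 0 < h.params.ν.A₀ :=
  h.admissible.toStage9.toStage8.1.2.2.2.1

/-! ## §2 NE7c at explicit carriers from `S_N16 (RRec₁₂ 𝔯)` BY NAME (threshold widths displayed) -/

section AtHome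

variable (𝔯 : RateReading₁₂ N) (hS : S_N16 (RRec₁₂ 𝔯)) {F : T4Family} {D : Datum F N} (h : IsDatumOfRecord₁₂C F N D)
  (g₀ : ℕ → ℝ) (os : List (ULoop F))
  {θ γE l₁ Λbar ε' cg : ℝ} (hθ : 0 < θ) (hθ1 : θ < 1) (hθ6 : θ ^ 6 = ((F.L : ℝ))⁻¹)
  (hN : ∀ K, 1 ≤ ((𝔯.lit F h.params h.provisos g₀ os).ne3 K).Nper) (hb : ∀ K, 0 ≤ ((𝔯.lit F h.params h.provisos g₀ os).ne3 K).b)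
  (hbs : ∀ K, 512 * (4 + 1) * (4 + 4) * (F.L : ℝ) ^ 2 * ((𝔯.lit F h.params h.provisos g₀ os).ne3 K).b ≤ 1)
  (hg : ∀ K, 0 ≤ ((𝔯.lit F h.params h.provisos g₀ os).ne3 K).g) (hC : ∀ K, 0 ≤ ((𝔯.lit F h.params h.provisos g₀ os).ne3 K).C)
  (hΛ₂' : ∀ K, 0 < ((𝔯.lit F h.params h.provisos g₀ os).ne3 K).Λ₂') (hΛbar : ∀ K, ((𝔯.lit F h.params h.provisos g₀ os).ne3 K).Λ₂' ≤ Λbar) (hγE : 0 < γE)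
  (hγ3 : ∀ K, ((𝔯.lit F h.params h.provisos g₀ os).ne3 K).C * (wallConst 4 F.L * (((𝔯.lit F h.params h.provisos g₀ os).ne3 K).Nper : ℝ) ^ 2 *
    (Real.sqrt ((𝔯.lit F h.params h.provisos g₀ os).ne3 K).g * dualC2 4 F.L + 2 * ((𝔯.lit F h.params h.provisos g₀ os).ne3 K).b ^ 2 * dualC1 4 F.L)) ≤ γE ^ 3)
  (hl₁ : 0 < l₁) (hΛl₁ : ∀ K, ((𝔯.lit F h.params h.provisos g₀ os).ne3 K).Λ₁ ≤ l₁ ^ 3) (hε' : 0 < ε') (hcg : 0 ≤ cg)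
  {ι σA σB : Type*} {l₀ : ℝ} {T : ℕ → Finset ι} {A B shA shB : ℕ → ℝ → ι → ℝ}
  {SA : ℕ → Finset σA} {SB : ℕ → Finset σB} {pieceA : ℕ → ℝ → σA → ι → ℝ} {pieceB : ℕ → ℝ → σB → ι → ℝ}
  {lvlA : ℕ → σA → ℕ} {lvlB : ℕ → σB → ℕ} {DA ρA DB ρB τA τB : ℕ → ℝ} {N₁ : ℕ} {νbar Dbar : ℝ}
  (hLA : LevelLedger l₀ T A shA SA pieceA lvlA DA ρA) (hLB : LevelLedger l₀ T B shB SB pieceB lvlB DB ρB)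
  (hwA : LiveWindow SA lvlA N₁ νbar) (hwB : LiveWindow SB lvlB N₁ νbar) (hDA : ∀ j, DA j ≤ Dbar) (hDB : ∀ j, DB j ≤ Dbar)
  (hdictA : ∀ j, 1 ≤ j → ∀ x : ℝ,
    (∀ (K : ℕ) (V UA UB : B7Prop1Explicit.Site 4 → Fin 4 → (Matrix (Fin N) (Fin N) ℂ)ˣ) (z : B7Prop1Explicit.Site 4) (μ ν : Fin 4) (t : ℝ),
      V ∈ ((𝔯.lit F h.params h.provisos g₀ os).ne3 K).dom →
      IsMinimiser 4 (sfClass 4 F.L ((𝔯.lit F h.params h.provisos g₀ os).ne3 K).Nper ((𝔯.lit F h.params h.provisos g₀ os).ne3 K).ε) F.L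
        ((𝔯.lit F h.params h.provisos g₀ os).ne3 K).Nper j V UA →
      IsMinimiser 4 (sfClass 4 F.L ((𝔯.lit F h.params h.provisos g₀ os).ne3 K).Nper ((𝔯.lit F h.params h.provisos g₀ os).ne3 K).ε) F.L
        ((𝔯.lit F h.params h.provisos g₀ os).ne3 K).Nper (j + 1) V UB →
      Regular 4 F.L ((𝔯.lit F h.params h.provisos g₀ os).ne3 K).Nper ((𝔯.lit F h.params h.provisos g₀ os).ne3 K).b
        ((𝔯.lit F h.params h.provisos g₀ os).ne3 K).g (j + 1) UB →
      ε' * ((F.L : ℝ)⁻¹) ^ (2 * j) ≤ t →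
      |‖((hol UA z (plaqWord μ ν) : (Matrix (Fin N) (Fin N) ℂ)ˣ) : Matrix (Fin N) (Fin N) ℂ) - 1‖
          - ‖((hol (rescale F.L (bavg F.L UB)) z (plaqWord μ ν) : (Matrix (Fin N) (Fin N) ℂ)ˣ) : Matrix (Fin N) (Fin N) ℂ) - 1‖| / t ≤ x) →
    ρA j ≤ x + τA j)
  (hdictB : ∀ j, 1 ≤ j → ∀ x : ℝ,
    (∀ (K : ℕ) (V UA UB : B7Prop1Explicit.Site 4 → Fin 4 → (Matrix (Fin N) (Fin N) ℂ)ˣ) (z : B7Prop1Explicit.Site 4) (π : Plane 4)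
      (r₀ : Fin 4 → Fin F.L) (i₀ j₀ : ℕ) (t : ℝ),
      V ∈ ((𝔯.lit F h.params h.provisos g₀ os).ne3 K).dom →
      IsMinimiser 4 (sfClass 4 F.L ((𝔯.lit F h.params h.provisos g₀ os).ne3 K).Nper ((𝔯.lit F h.params h.provisos g₀ os).ne3 K).ε) F.L
        ((𝔯.lit F h.params h.provisos g₀ os).ne3 K).Nper j V UA →
      IsMinimiser 4 (sfClass 4 F.L ((𝔯.lit F h.params h.provisos g₀ os).ne3 K).Nper ((𝔯.lit F h.params h.provisos g₀ os).ne3 K).ε) F.L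
        ((𝔯.lit F h.params h.provisos g₀ os).ne3 K).Nper (j + 1) V UB →
      Regular 4 F.L ((𝔯.lit F h.params h.provisos g₀ os).ne3 K).Nper ((𝔯.lit F h.params h.provisos g₀ os).ne3 K).b
        ((𝔯.lit F h.params h.provisos g₀ os).ne3 K).g (j + 1) UB →
      RegularSup 4 F.L ((𝔯.lit F h.params h.provisos g₀ os).ne3 K).Nper ((𝔯.lit F h.params h.provisos g₀ os).ne3 K).b cg (j + 1) UB →
      i₀ < F.L → j₀ < F.L → ε' * ((F.L : ℝ)⁻¹) ^ (2 * j) ≤ t →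
      |‖((hol UA z (plaqWord π.1.1 π.1.2) : (Matrix (Fin N) (Fin N) ℂ)ˣ) : Matrix (Fin N) (Fin N) ℂ) - 1‖
          - (F.L : ℝ) ^ 2 * ‖((hol UB ((F.L : ℤ) • z + boxVec F.L r₀ + (i₀ : ℤ) • e π.1.1 + (j₀ : ℤ) • e π.1.2)
              (plaqWord π.1.1 π.1.2) : (Matrix (Fin N) (Fin N) ℂ)ˣ) : Matrix (Fin N) (Fin N) ℂ) - 1‖| / t ≤ x) →
    ρB j ≤ x + τB j)

include hS hθ hθ1 hθ6 hN hb hbs hg hC hΛ₂' hΛbar hγE hγ3 hl₁ hΛl₁ hε' hcg hLA hLB hwA hwB hDA hDB hdictA hdictB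

/-- **NE7c AT EXPLICIT CARRIERS FROM `S_N16 (RRec₁₂ 𝔯)` BY NAME (variable width; threshold widths displayed).**  DATA: a Stage-12 rate reading `𝔯` with the K4 stub
`S_N16 (RRec₁₂ 𝔯)`; a datum key `h : IsDatumOfRecord₁₂C F N D`, `(g₀, os)`; the reading's NE3 layers `(𝔯.lit F h.params h.provisos g₀ os).ne3 K` with run-length-uniform END
letters and a family base `θ`; explicit carriers `(l₀, T, A, B, shA, shB)` with level ledgers ([dict] + (M1)), live windows (N20), `D ≤ D̄` (N12); threshold widths
`τA, τB ≤ c₂ϑ₂^j` and the two [dict] clauses.  CONCLUSION: `∃ C ≥ 0`, `ShellWeightBound l₀ T A B shA shB (K ↦ C·(θ ∨ ϑ₂)^K)` — module 5 at the layers, the in-edge by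
`s_N16_rRec₁₂_iff`.  CONDITIONAL on every displayed binder; NE7c NOT proved; N21 NOT discharged. [folklore] -/
theorem shellWeightBound_geometric_of_rRec₁₂ {c₂ ϑ₂ : ℝ} (hc₂ : 0 ≤ c₂) (h₂ : 0 ≤ ϑ₂) (h₂' : ϑ₂ < 1)
    (hτA : ∀ j, τA j ≤ c₂ * ϑ₂ ^ j) (hτB : ∀ j, τB j ≤ c₂ * ϑ₂ ^ j) :
    ∃ C : ℝ, 0 ≤ C ∧ ShellWeightBound l₀ T A B shA shB fun K => C * max θ ϑ₂ ^ K :=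
  shellWeightBound_geometric_of_ne3Layers (o := fun K => (𝔯.lit F h.params h.provisos g₀ os).ne3 K)
    (fun K => (s_N16_rRec₁₂_iff 𝔯).1 hS F D h g₀ os K) hθ hθ1 hθ6 hN hb hbs hg hC hΛ₂' hΛbar hγE hγ3 hl₁ hΛl₁ hε' hcg hLA hLB hwA hwB hDA hDB
    hc₂ h₂ h₂' hτA hτB hdictA hdictB

/-! ## §3 Both width families BY NAME at the Stage-12 home: `S_N16 (RRec₁₂ 𝔯)` + node U2 at the datum, in the record's own coupling window -/

/-- **NE7c AT EXPLICIT CARRIERS FROM `S_N16 (RRec₁₂ 𝔯)` AND NODE U2's OUTPUT AT THE DATUM OF RECORD.**  As `shellWeightBound_geometric_of_rRec₁₂`, with the threshold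
widths supplied BY NAME: node U2's `U2Output D g₀ Cout θ₂` (`0 ≤ θ₂ < 1`), a bare sequence tuned IN THE RECORD's OWN WINDOW `D.Tuned h.params.γ g g₀`, the smallness
`(1 + p₀∕log γ⁻²)γ²Cout ≤ 1∕2` at `γ = h.params.γ`, `ν = h.params.ν`, and the two [dict-thr] clauses against the thresholds of record `Node00.epsOfRecord h.params.ν` along
the matched runs; `0 ≤ ν.A₀` (§1) and `γ < 1` (`IsDatumOfRecord₁₂C.gamma_lt_one`) are READ OFF the datum.  CONCLUSION: `∃ C ≥ 0`, `ShellWeightBound l₀ T A B shA shB (K ↦ C·(θ ∨ θ₂)^K)` — module 6 at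
the layers.  CONDITIONAL on every displayed binder; NE7c NOT proved; N21 NOT discharged. [folklore] -/
theorem shellWeightBound_geometric_of_rRec₁₂_u2Output {Cout θ₂ g : ℝ} (hU2 : U2Output D g₀ Cout θ₂) (h₂ : 0 ≤ θ₂) (h₂' : θ₂ < 1)
    (ht : D.Tuned h.params.γ g g₀) (hsmall : (1 + h.params.ν.p₀ / Real.log (h.params.γ ^ 2)⁻¹) * h.params.γ ^ 2 * Cout ≤ 1 / 2)
    (hthrA : ∀ j, ∀ x : ℝ, (∀ K, j ≤ K →
      |epsOfRecord h.params.ν (runFlow D g₀ K) j - epsOfRecord h.params.ν (runFlow D g₀ (K + 1)) (j + 1)| ≤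
        x * epsOfRecord h.params.ν (runFlow D g₀ K) j) → τA j ≤ x)
    (hthrB : ∀ j, ∀ x : ℝ, (∀ K, j ≤ K →
      |epsOfRecord h.params.ν (runFlow D g₀ K) j - epsOfRecord h.params.ν (runFlow D g₀ (K + 1)) (j + 1)| ≤
        x * epsOfRecord h.params.ν (runFlow D g₀ (K + 1)) (j + 1)) → τB j ≤ x) :
    ∃ C : ℝ, 0 ≤ C ∧ ShellWeightBound l₀ T A B shA shB fun K => C * max θ θ₂ ^ K :=
  shellWeightBound_geometric_of_ne3Layers_u2Output (o := fun K => (𝔯.lit F h.params h.provisos g₀ os).ne3 K)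
    (fun K => (s_N16_rRec₁₂_iff 𝔯).1 hS F D h g₀ os K) hθ hθ1 hθ6 hN hb hbs hg hC hΛ₂' hΛbar hγE hγ3 hl₁ hΛl₁ hε' hcg
    h.params.ν (nu_A0_pos_of_isDatumOfRecord₁₂C h).le D g₀ hU2 h₂ h₂' h.gamma_lt_one (box_and_pin_of_tuned D ht).1 hsmall
    hLA hLB hwA hwB hDA hDB hdictA hdictB hthrA hthrB

end AtHome

end Summit.QuantumFields.YangMills.Theorems.N21AtRRec12

end
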